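import Summits.QuantumAdvantage.QuantumAdvantage.Theorems.DegreeOnePrimesEscape.Negative.EscapeCounting
import Literature.NumberTheory.LFunctions.PrimeIdealCountDegreeOne
import Literature.NumberTheory.LFunctions.UniformClassGroupPNT
import HarnessLib

/-!
# Degree-one primes in an ideal class: counting lemmas and numerics for the per-character deficit

Topic `Summits/QuantumAdvantage/QuantumAdvantage/Theorems`, helper for the stub
`stub_perCharacterDeficit_of_density` (line `subgroup-orthogonality-escape`, crux
`DegreeOnePrimesEscape`, stmt-QuantumAdvantage-11543).

* `degOneClassCount K C x` — the number of degree-one primes (prime norm) of norm `≤ x` in the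
  class `C` (verbatim the counting function of the line skeleton and of the stub statements);
* `degOneClassCount_le` (`≤ π_C(x)`), `primeIdealCount_le_sum_degOneClassCount_add`
  (`π_K(x) ≤ Σ_C degOneClassCount + n(√x + 1)`: primes of degree `≥ 2` are few), `sum_re_mul_le_add`
  — copied, with their proofs, from the line skeleton `Lines/subgroup-orthogonality-escape.lean`
  §3/§5 so that the stub file does not import a sorried skeleton;
* numerics: `pow_bound_twelve`, `size_ineq_deficit`, and the absorption `unsmoothing_small` of the
  signed unsmoothing error `n(log t + 1)(8√t + 2t^{1−ν} + 1) ≤ η t`.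
-/

noncomputable section

open scoped NumberField nonZeroDivisors
open Literature.NumberTheory.LFunctions Literature.NumberTheory.LFunctions.NumberField
open Summit.QuantumAdvantage.QuantumAdvantage.Theorems.DegreeOnePrimesEscape.Negative
  (degOneInClass degOneInClass_finite degOneInClass_disjoint)

namespace Summit.QuantumAdvantage.QuantumAdvantage.Theorems.DegreeOnePrimesEscape

/-- Degree-one primes of `K` of norm `≤ x` in the class `C`. [folklore] -/
def degOneClassCount (K : Type) [Field K] [NumberField K] (C : ClassGroup (𝓞 K)) (x : ℝ) : ℕ :=
  Set.ncard {P : Ideal (𝓞 K) | (Ideal.absNorm P).Prime ∧ (Ideal.absNorm P : ℝ) ≤ x ∧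
    ∃ hP : P ∈ (Ideal (𝓞 K))⁰, ClassGroup.mk0 ⟨P, hP⟩ = C}

/-! ### Counting: all primes versus degree-one primes (copied from the line skeleton §3, §5) -/

open Classical in
/-- **Degree-one primes, counted by norm**: the nonzero primes of prime norm `≤ x` number
`∑_{p ≤ x} #{𝔭 : N𝔭 = p}` (the tree's `normPrimeIdealCount`). [folklore] -/
theorem ncard_degOne_eq_sum (K : Type) [Field K] [NumberField K] (x : ℕ) :
    Set.ncard {P : Ideal (𝓞 K) | P.IsPrime ∧ P ≠ ⊥ ∧ (Ideal.absNorm P).Prime ∧ Ideal.absNorm P ≤ x}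
      = ∑ p ∈ (Finset.Icc 0 x).filter Nat.Prime, normPrimeIdealCount K p := by
  set S : Set (Ideal (𝓞 K)) :=
    {P : Ideal (𝓞 K) | P.IsPrime ∧ P ≠ ⊥ ∧ (Ideal.absNorm P).Prime ∧ Ideal.absNorm P ≤ x} with hSdef
  have hSfin : S.Finite := by
    refine (Ideal.finite_setOf_absNorm_le (S := 𝓞 K) x).subset ?_
    rintro P ⟨-, -, -, h4⟩
    exact h4
  rw [Set.ncard_eq_toFinset_card S hSfin]
  rw [Finset.card_eq_sum_card_fiberwise (f := fun P : Ideal (𝓞 K) => Ideal.absNorm P)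
    (t := (Finset.Icc 0 x).filter Nat.Prime) ?_]
  · apply Finset.sum_congr rfl
    intro p hp
    rw [Finset.mem_filter] at hp
    rw [normPrimeIdealCount, ← Set.ncard_coe_finset]
    congr 1
    ext P
    simp only [Finset.coe_filter, Set.Finite.mem_toFinset, Set.mem_setOf_eq, hSdef]
    constructor
    · rintro ⟨⟨h1, h2, -, -⟩, h5⟩
      exact ⟨h1, h2, h5⟩
    · rintro ⟨h1, h2, h5⟩
      refine ⟨⟨h1, h2, ?_, ?_⟩, h5⟩
      · rw [h5]; exact hp.2
      · rw [h5]; exact (Finset.mem_Icc.1 hp.1).2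
  · intro P hPS
    rw [Finset.mem_coe, Set.Finite.mem_toFinset] at hPS
    obtain ⟨-, -, h3, h4⟩ := hPS
    rw [Finset.mem_coe, Finset.mem_filter, Finset.mem_Icc]
    exact ⟨⟨Nat.zero_le _, h4⟩, h3⟩

open Classical in
/-- `π_K(x) ≤ #{degree-one primes ≤ x} + [K:ℚ]·π(√x)` (tree lemmas
`primeIdealCount_eq_sum_normPrimeIdealCount`, `sum_normPrimeIdealCount_not_prime_le`). [folklore] -/
theorem primeIdealCount_le_degOne_add (K : Type) [Field K] [NumberField K] (x : ℕ) :
    primeIdealCount K x ≤ ∑ p ∈ (Finset.Icc 0 x).filter Nat.Prime, normPrimeIdealCount K p +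
      Module.finrank ℚ K * Nat.primeCounting (Nat.sqrt x) := by
  have hx : (0 : ℝ) ≤ x := Nat.cast_nonneg x
  rw [primeIdealCount_eq_sum_normPrimeIdealCount K hx, Nat.floor_natCast,
    ← Finset.sum_filter_add_sum_filter_not (Finset.Icc 0 x) Nat.Prime]
  exact Nat.add_le_add_left (sum_normPrimeIdealCount_not_prime_le K x) _


open Classical in
/-- All degree-one primes of norm `≤ x`, fibred over the class group. [folklore] -/
theorem ncard_degOne_eq_sum_classes (K : Type) [Field K] [NumberField K] (x : ℕ) :
    Set.ncard {P : Ideal (𝓞 K) | P.IsPrime ∧ P ≠ ⊥ ∧ (Ideal.absNorm P).Prime ∧ Ideal.absNorm P ≤ x}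
      = ∑ C : ClassGroup (𝓞 K), (degOneInClass K x C).ncard := by
  set t : ClassGroup (𝓞 K) → Finset (Ideal (𝓞 K)) :=
    fun C => (degOneInClass_finite K x C).toFinset with ht
  have hU : {P : Ideal (𝓞 K) | P.IsPrime ∧ P ≠ ⊥ ∧ (Ideal.absNorm P).Prime ∧ Ideal.absNorm P ≤ x}
      = ↑((Finset.univ : Finset (ClassGroup (𝓞 K))).biUnion t) := by
    ext P
    simp only [Finset.coe_biUnion, Finset.coe_univ, Set.mem_univ, Set.iUnion_true, Set.mem_iUnion,
      ht, Set.Finite.coe_toFinset, degOneInClass, Set.mem_setOf_eq]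
    constructor
    · rintro ⟨h1, h2, h3, h4⟩
      exact ⟨ClassGroup.mk0 ⟨P, mem_nonZeroDivisors_of_ne_zero h2⟩, h1, h3, h4,
        mem_nonZeroDivisors_of_ne_zero h2, rfl⟩
    · rintro ⟨C, h1, h3, h4, hP, -⟩
      exact ⟨h1, nonZeroDivisors.ne_zero hP, h3, h4⟩
  have hdisj : (↑(Finset.univ : Finset (ClassGroup (𝓞 K))) : Set (ClassGroup (𝓞 K))).PairwiseDisjoint t := by
    intro C _ C' _ hne
    rw [Function.onFun, Finset.disjoint_coe.symm]
    simpa [ht] using degOneInClass_disjoint K x hne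
  rw [hU, Set.ncard_coe_finset, Finset.card_biUnion hdisj]
  refine Finset.sum_congr rfl fun C _ => ?_
  rw [ht, Set.ncard_eq_toFinset_card _ (degOneInClass_finite K x C)]

/-- Bridge between the stub's `degOneClassCount` (real `x`, no `IsPrime` clause) and the fibre
`degOneInClass` of the crux's counted set (an ideal of prime norm is prime,
Mathlib `Ideal.isPrime_of_irreducible_absNorm`). [folklore] -/
theorem degOneClassCount_natCast (K : Type) [Field K] [NumberField K] (x : ℕ)
    (C : ClassGroup (𝓞 K)) : degOneClassCount K C (x : ℝ) = (degOneInClass K x C).ncard := by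
  unfold degOneClassCount degOneInClass
  congr 1
  ext P
  simp only [Set.mem_setOf_eq, Nat.cast_le]
  constructor
  · rintro ⟨h1, h2, h3⟩
    exact ⟨Ideal.isPrime_of_irreducible_absNorm h1, h1, h2, h3⟩
  · rintro ⟨-, h1, h2, h3⟩
    exact ⟨h1, h2, h3⟩


/-- For `x ≥ 0` the real cut-off `N P ≤ x` only sees `⌊x⌋₊`. [folklore] -/
theorem degOneClassCount_floor (K : Type) [Field K] [NumberField K] (C : ClassGroup (𝓞 K)) {x : ℝ}
    (hx : 0 ≤ x) : degOneClassCount K C x = degOneClassCount K C (⌊x⌋₊ : ℝ) := by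
  unfold degOneClassCount
  congr 1
  ext P
  simp only [Set.mem_setOf_eq, Nat.cast_le]
  rw [← Nat.le_floor_iff hx]

/-- For `x ≥ 0` the count `π_K(x)` only sees `⌊x⌋₊`. [folklore] -/
theorem primeIdealCount_floor (K : Type) [Field K] [NumberField K] {x : ℝ} (hx : 0 ≤ x) :
    primeIdealCount K x = primeIdealCount K (⌊x⌋₊ : ℝ) := by
  unfold primeIdealCount primeIdealsLE
  congr 1
  ext P
  simp only [Set.mem_setOf_eq, Nat.cast_le]
  rw [← Nat.le_floor_iff hx]

/-- Degree-one primes in a class are among all primes in the class. [folklore] -/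
theorem degOneClassCount_le (K : Type) [Field K] [NumberField K] (C : ClassGroup (𝓞 K)) (x : ℝ) :
    degOneClassCount K C x ≤ primeIdealClassCount K C x := by
  unfold degOneClassCount primeIdealClassCount
  refine Set.ncard_le_ncard ?_ (finite_primeIdealsInClassLE C x)
  rintro P ⟨h1, h2, hP, h3⟩
  exact ⟨Ideal.isPrime_of_irreducible_absNorm h1, h2, hP, h3⟩

/-- **Degree ≥ 2 primes are few, class by class in total**:
`π_K(x) ≤ ∑_C #(deg-1 primes ≤ x in C) + [K:ℚ]·(√x + 1)`. [folklore] -/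
theorem primeIdealCount_le_sum_degOneClassCount_add (K : Type) [Field K] [NumberField K] {x : ℝ}
    (hx : 0 ≤ x) :
    (primeIdealCount K x : ℝ) ≤ ∑ C : ClassGroup (𝓞 K), (degOneClassCount K C x : ℝ) +
      (Module.finrank ℚ K : ℝ) * (Real.sqrt x + 1) := by
  classical
  set N : ℕ := ⌊x⌋₊ with hN
  have h1 : primeIdealCount K x = primeIdealCount K (N : ℝ) := primeIdealCount_floor K hx
  have h2 := primeIdealCount_le_degOne_add K N
  have h3 : Set.ncard {P : Ideal (𝓞 K) | P.IsPrime ∧ P ≠ ⊥ ∧ (Ideal.absNorm P).Prime ∧ Ideal.absNorm P ≤ N}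
      = ∑ p ∈ (Finset.Icc 0 N).filter Nat.Prime, normPrimeIdealCount K p := ncard_degOne_eq_sum K N
  have h4 := ncard_degOne_eq_sum_classes K N
  have h5 : ∀ C : ClassGroup (𝓞 K), degOneClassCount K C x = (degOneInClass K N C).ncard := by
    intro C
    rw [degOneClassCount_floor K C hx, ← hN, degOneClassCount_natCast K N C]
  have hsum : (∑ C : ClassGroup (𝓞 K), (degOneClassCount K C x : ℝ)) =
      ((Set.ncard {P : Ideal (𝓞 K) | P.IsPrime ∧ P ≠ ⊥ ∧ (Ideal.absNorm P).Prime ∧ Ideal.absNorm P ≤ N} : ℕ) : ℝ) := by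
    rw [h4]; push_cast
    exact Finset.sum_congr rfl fun C _ => by rw [h5 C]
  -- π(√N) ≤ √N + 1 ≤ √x + 1
  have hpisqrt : (Nat.primeCounting (Nat.sqrt N) : ℝ) ≤ Real.sqrt x + 1 := by
    have ha : Nat.primeCounting (Nat.sqrt N) ≤ Nat.sqrt N + 1 := by
      rw [Nat.primeCounting, Nat.primeCounting']
      exact Nat.count_le _
    have hb : ((Nat.sqrt N : ℕ) : ℝ) ≤ Real.sqrt (N : ℝ) := by
      rw [Real.le_sqrt (by positivity) (by positivity)]
      exact_mod_cast Nat.sqrt_le' N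
    have hc : Real.sqrt (N : ℝ) ≤ Real.sqrt x := Real.sqrt_le_sqrt (Nat.floor_le hx)
    calc (Nat.primeCounting (Nat.sqrt N) : ℝ) ≤ (Nat.sqrt N : ℝ) + 1 := by exact_mod_cast ha
      _ ≤ Real.sqrt x + 1 := by linarith
  have h2' : ((primeIdealCount K (N : ℝ) : ℕ) : ℝ) ≤
      ((Set.ncard {P : Ideal (𝓞 K) | P.IsPrime ∧ P ≠ ⊥ ∧ (Ideal.absNorm P).Prime ∧ Ideal.absNorm P ≤ N} : ℕ) : ℝ)
        + (Module.finrank ℚ K : ℝ) * (Nat.primeCounting (Nat.sqrt N) : ℝ) := by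
    rw [h3]; exact_mod_cast h2
  have hn0 : (0 : ℝ) ≤ Module.finrank ℚ K := Nat.cast_nonneg _
  have h6 : (Module.finrank ℚ K : ℝ) * (Nat.primeCounting (Nat.sqrt N) : ℝ) ≤
      (Module.finrank ℚ K : ℝ) * (Real.sqrt x + 1) := mul_le_mul_of_nonneg_left hpisqrt hn0
  rw [h1, hsum]
  linarith

/-- Abstract step 1: replacing `a ≤ π` by `π` costs at most `∑ (π − a)` when `|re| ≤ 1`. [folklore] -/
theorem sum_re_mul_le_add {ι : Type*} [Fintype ι] (re a π : ι → ℝ) (hre : ∀ i, |re i| ≤ 1)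
    (haπ : ∀ i, a i ≤ π i) :
    ∑ i, re i * a i ≤ ∑ i, re i * π i + (∑ i, π i - ∑ i, a i) := by
  rw [← Finset.sum_sub_distrib, ← Finset.sum_add_distrib]
  refine Finset.sum_le_sum fun i _ => ?_
  have h1 := (abs_le.mp (hre i)).1
  have h2 := haπ i
  nlinarith

/-! ### Numerics -/

/-- `(10⁴(n+1))⁴ ≤ 12^{4n+16}`. -/
theorem pow_bound_twelve (n : ℕ) : (10000 * (n + 1)) ^ 4 ≤ 12 ^ (4 * n + 16) := by
  have h1 : n + 1 ≤ 12 ^ n := by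
    have := Nat.lt_pow_self (show 1 < 12 by norm_num) (n := n)
    omega
  have h2 : 10000 * (n + 1) ≤ 12 ^ (n + 4) := by
    rw [pow_add]; nlinarith [show (10000:ℕ) ≤ 12 ^ 4 by norm_num]
  calc (10000 * (n + 1)) ^ 4 ≤ (12 ^ (n + 4)) ^ 4 := Nat.pow_le_pow_left h2 4
    _ = 12 ^ (4 * n + 16) := by rw [← pow_mul]; ring_nf

/-- Numerical size lemma: for `x ≥ (10⁴(n+1))⁴`, `152 n √x + 8n + 2 ≤ (3/10) · x/log x`
(via `t = x^{1/4}`, `log x ≤ 4t`). -/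
theorem size_ineq_deficit (n : ℕ) {x : ℝ} (hx : ((10000 * ((n : ℝ) + 1)) ^ 4) ≤ x) :
    152 * (n : ℝ) * Real.sqrt x + 8 * n + 2 ≤ 3 / 10 * (x / Real.log x) := by
  have hn0 : (0 : ℝ) ≤ n := Nat.cast_nonneg n
  have h100 : (10000 : ℝ) ≤ 10000 * ((n : ℝ) + 1) := by nlinarith
  have hx1e : (10000 : ℝ) ^ 4 ≤ x := le_trans (pow_le_pow_left₀ (by norm_num) h100 4) hx
  have hxpos : 0 < x := by linarith [show (0:ℝ) < 10000 ^ 4 by norm_num]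
  set t : ℝ := x ^ ((1:ℝ)/4) with ht
  have htpos : 0 < t := Real.rpow_pos_of_pos hxpos _
  have ht4 : t ^ 4 = x := by
    rw [ht, ← Real.rpow_natCast, ← Real.rpow_mul hxpos.le]; norm_num
  have ht2 : t ^ 2 = Real.sqrt x := by
    rw [ht, ← Real.rpow_natCast, ← Real.rpow_mul hxpos.le, Real.sqrt_eq_rpow]; norm_num
  have htge : 10000 * ((n : ℝ) + 1) ≤ t := by
    have : (10000 * ((n : ℝ) + 1)) = ((10000 * ((n : ℝ) + 1)) ^ 4) ^ ((1:ℝ)/4) := by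
      rw [← Real.rpow_natCast, ← Real.rpow_mul (by positivity)]; norm_num
    rw [this, ht]
    exact Real.rpow_le_rpow (by positivity) hx (by norm_num)
  have ht1 : 1 ≤ t := by linarith
  have hlog : Real.log x ≤ 4 * t := by
    have := Real.log_le_rpow_div hxpos.le (show (0:ℝ) < 1/4 by norm_num)
    rw [← ht] at this
    linarith
  have hx1 : 1 < x := by linarith [show (1:ℝ) < 10000 ^ 4 by norm_num]
  have hlogpos : 0 < Real.log x := Real.log_pos hx1
  have hquot : t ^ 3 / 4 ≤ x / Real.log x := by
    rw [div_le_div_iff₀ (by norm_num) hlogpos]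
    calc t ^ 3 * Real.log x ≤ t ^ 3 * (4 * t) :=
          mul_le_mul_of_nonneg_left hlog (pow_pos htpos 3).le
      _ = x * 4 := by rw [← ht4]; ring
  rw [← ht2]
  have hA : 750 * ((n : ℝ) + 1) * t ^ 2 ≤ 3 / 40 * t ^ 3 := by
    have := mul_le_mul_of_nonneg_right htge (by positivity : (0:ℝ) ≤ 3 / 40 * t ^ 2)
    nlinarith
  have hB : 8 * (n : ℝ) + 2 ≤ (8 * n + 2) * t ^ 2 := by
    have : (1 : ℝ) ≤ t ^ 2 := one_le_pow₀ ht1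
    nlinarith
  nlinarith [hA, hB, hquot, sq_nonneg t]

/-- **Absorption of the unsmoothing error**: `n (log t + 1)(8√t + 2 t^{−ν} t + 1) ≤ η t` once
`t ≥ e` and `log t ≥ (2/ν) log(44(n+1)/(νη))` (`0 < ν ≤ 1/2`). -/
theorem unsmoothing_small {n ν η t : ℝ} (hn : 0 ≤ n) (hν : 0 < ν) (hν2 : ν ≤ 1 / 2) (hη : 0 < η)
    (ht : Real.exp 1 ≤ t) (hlarge : 2 / ν * Real.log (44 * (n + 1) / (ν * η)) ≤ Real.log t) :
    n * ((Real.log t + 1) * (8 * Real.sqrt t + 2 * t ^ (-ν) * t + 1)) ≤ η * t := by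
  have ht1 : 1 < t := lt_of_lt_of_le (by have := Real.exp_one_gt_d9; linarith) ht
  have ht0 : 0 < t := by linarith
  set L := Real.log t with hL
  have hL1 : 1 ≤ L := by rw [hL, Real.le_log_iff_exp_le ht0]; exact ht
  -- the bracket is `≤ 11 t^{1-ν}`
  have hpow : t ^ (-ν) * t = t ^ (1 - ν) := by
    rw [sub_eq_add_neg, Real.rpow_add ht0, Real.rpow_one]; ring
  have hsqrt : Real.sqrt t ≤ t ^ (1 - ν) := by
    rw [Real.sqrt_eq_rpow]
    exact Real.rpow_le_rpow_of_exponent_le ht1.le (by linarith)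
  have hone : (1 : ℝ) ≤ t ^ (1 - ν) := Real.one_le_rpow ht1.le (by linarith)
  have hbr : 8 * Real.sqrt t + 2 * t ^ (-ν) * t + 1 ≤ 11 * t ^ (1 - ν) := by
    rw [mul_assoc, hpow]; linarith
  have hlog2 : L + 1 ≤ 2 * L := by linarith
  have hP0 : 0 ≤ t ^ (1 - ν) := Real.rpow_nonneg ht0.le _
  have h1 : n * ((L + 1) * (8 * Real.sqrt t + 2 * t ^ (-ν) * t + 1)) ≤ 22 * n * L * t ^ (1 - ν) := by
    have := mul_le_mul hlog2 hbr (by positivity) (by linarith)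
    have := mul_le_mul_of_nonneg_left this hn
    linarith
  -- `L ≤ (2/ν) t^{ν/2}` and `44 n/ν ≤ η t^{ν/2}`
  have hLle : L ≤ t ^ (ν / 2) / (ν / 2) := Real.log_le_rpow_div ht0.le (by positivity)
  have hkey : 44 * (n + 1) / (ν * η) ≤ t ^ (ν / 2) := by
    have h2 : Real.log (44 * (n + 1) / (ν * η)) ≤ ν / 2 * L := by
      have := (le_div_iff₀' (by positivity : (0:ℝ) < 2 / ν)).2 hlarge
      calc Real.log (44 * (n + 1) / (ν * η)) ≤ L / (2 / ν) := this
        _ = ν / 2 * L := by field_simp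
    calc 44 * (n + 1) / (ν * η) = Real.exp (Real.log (44 * (n + 1) / (ν * η))) :=
          (Real.exp_log (by positivity)).symm
      _ ≤ Real.exp (ν / 2 * L) := Real.exp_le_exp.2 h2
      _ = t ^ (ν / 2) := by rw [hL, Real.rpow_def_of_pos ht0]; ring_nf
  have hkey' : 44 * n / ν ≤ η * t ^ (ν / 2) := by
    have h3 := (div_le_iff₀ (by positivity : (0:ℝ) < ν * η)).1 hkey
    rw [div_le_iff₀ hν]
    nlinarith [Real.rpow_nonneg ht0.le (ν / 2)]
  have hsplit : t = t ^ (ν / 2) * (t ^ (ν / 2) * t ^ (1 - ν)) := by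
    rw [← Real.rpow_add ht0, ← Real.rpow_add ht0]; ring_nf; exact (Real.rpow_one t).symm
  calc n * ((L + 1) * (8 * Real.sqrt t + 2 * t ^ (-ν) * t + 1))
      ≤ 22 * n * L * t ^ (1 - ν) := h1
    _ ≤ 22 * n * (t ^ (ν / 2) / (ν / 2)) * t ^ (1 - ν) :=
        mul_le_mul_of_nonneg_right (mul_le_mul_of_nonneg_left hLle (by positivity)) hP0
    _ = (44 * n / ν) * (t ^ (ν / 2) * t ^ (1 - ν)) := by field_simp; ring
    _ ≤ (η * t ^ (ν / 2)) * (t ^ (ν / 2) * t ^ (1 - ν)) :=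
        mul_le_mul_of_nonneg_right hkey' (by positivity)
    _ = η * (t ^ (ν / 2) * (t ^ (ν / 2) * t ^ (1 - ν))) := by ring
    _ = η * t := by rw [← hsplit]


/-- Closed form of `primeIdealCount_le_sum_degOneClassCount_add`: the registered sub-goal of the stub `stub_perCharacterDeficit_of_density`
proved by this file. -/
theorem perCharacterDeficit_counting : ∀ (K : Type) [Field K] [NumberField K] {x : ℝ}
    (hx : 0 ≤ x),
    (primeIdealCount K x : ℝ) ≤ ∑ C : ClassGroup (𝓞 K), (degOneClassCount K C x : ℝ) +
      (Module.finrank ℚ K : ℝ) * (Real.sqrt x + 1) :=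
  @primeIdealCount_le_sum_degOneClassCount_add

end Summit.QuantumAdvantage.QuantumAdvantage.Theorems.DegreeOnePrimesEscape

end
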